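import Literature.NumberTheory.DiophantineGeometry.GenEllFullGalois
import Mathlib.AlgebraicGeometry.EllipticCurve.ModelsWithJ
import Mathlib.LinearAlgebra.Transvection.Basic
import Mathlib.LinearAlgebra.Dual.Lemmas
import Mathlib.NumberTheory.Padics.PadicVal.Basic
import HarnessLib

/-!
# [GenEll] §3 predicate rows of the FACT-LIST, settled AS TYPED at the curve `y² + y = x³`

S. Mochizuki, *Arithmetic elliptic curves in general position*, Math. J. Okayama Univ. 52 (2010)
[cite: MochizukiGenEll2010], §3 pp. 15–19. Four declarations of the tree's [GenEll] §3 vocabulary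
are *parametrised predicates* — each is a HYPOTHESIS of a printed statement, read at a presented
curve `P : EllPoint` (resp. at an `ε`): `EllPoint.HasMultPlace` (Lem. 3.7 p. 18),
`EllPoint.ImageModLContainsSL2` (Thm. 3.8 p. 19), `EllPoint.AdmitsLCyclic` (Lem. 3.5 p. 17),
`prop34Ineq` (Prop. 3.4 p. 17). The cell's frozen FACT-LIST (rows F-2744 / F-2746 / F-2754 / F-2759,
plan/F-TRANCHES.tsv tranches 179–180) lists them as candidate named facts; a named fact is consumed
through its universal closure, and each of the four closures is FALSE. This proof-only file records
the refutations of the first three at ONE explicit curve `E₀ : y² + y = x³` over `ℚ` (Mathlib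
`WeierstrassCurve.ofJ 0 = ofJ0 ℚ`, `j = 0`); the fourth (F-2759, at `ε = −1`, via
`ht_∞([ofJ n]) = log n`) is `not_forall_prop34Ineq` of `GenEllProp34IneqClosure.lean`:

* F-2744: `c₄(E₀) = 0`, so `c₄ = 0` for every local minimal model and no place is multiplicative
  (`ord_v(c₄) = 0` is required): `not_forall_hasMultPlace`.
* F-2746 (`l = 3`): the flex `T = (0,0) ∈ E₀[3]` is rational, hence `Γ_ℚ`-fixed, while the
  `SL₂`-transvection `x ↦ x + φ(x)·S` (`S = (−1, ω) ∈ E₀[3]`, `ω² + ω + 1 = 0`, `φ(S) = 0 ≠ φ(T)`;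
  determinant `1` by Mathlib `LinearEquiv.transvection.det_eq_one`) moves `T`:
  `not_forall_imageModLContainsSL2`.
* F-2754 (`l = 2`): a `Γ_ℚ`-stable order-`2` subgroup of `E₀[2]` is `{0, T}` with `T` `Γ_ℚ`-fixed of
  order `2`, i.e. (Galois descent) rational with `2y + 1 = 0`, whence `x³ = −1/4` — no rational
  solution (`2`-adic valuation): `not_forall_admitsLCyclic`.

Positive instance forms in the tree are cited by name and untouched: `admitsLCyclic_one`
(`GenEllVocabularyClosures.lean`), the conditional Lem. 3.7 / Thm. 3.8 forms of
`GenEllFullGaloisProofs.lean`, `GenEll_lemma35` / `GenEll_thm38` (which ASSUME resp. CONCLUDE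
these predicates under the printed conditions). HONEST FRAMING: classical, undisputed; a refuted universal closure of a predicate says
nothing about the printed lemma whose hypothesis it is; no side taken on [IUTchIII] Cor. 3.12. -/

noncomputable section

open scoped Classical
open NumberField IsDedekindDomain WeierstrassCurve

namespace Literature.NumberTheory.DiophantineGeometry.GenEll

/-- Over `ℚ`, Mathlib's `ofJ 0` is the curve `ofJ0 = ⟨0, 0, 1, 0, 0⟩`, i.e. `y² + y = x³`.
[cite: MochizukiGenEll2010, §3 p.16] -/
theorem ofJ_zero_rat : ofJ (0 : ℚ) = ofJ0 ℚ := ofJ_0_of_three_ne_zero (by norm_num)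

/-- `c₄(E₀) = 0`. [cite: MochizukiGenEll2010, §3 p.16] -/
theorem ofJ_zero_rat_c₄ : (ofJ (0 : ℚ)).c₄ = 0 := by rw [ofJ_zero_rat]; exact ofJ0_c₄ ℚ

section MultPlace

variable {A : Type*} [CommRing A] [IsDedekindDomain A] {K : Type*} [Field K] [Algebra A K]
  [IsFractionRing A K]

/-- If `c₄(W) = 0` then every local minimal model of `W` has `c₄ = 0` (`c₄` changes by the unit
`u⁻⁴` under a change of variables). [cite: MochizukiGenEll2010, Lem 3.7 p.18] -/
theorem localMinimalModel_c₄_eq_zero (v : HeightOneSpectrum A) (W : WeierstrassCurve K)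
    (hW : W.c₄ = 0) : (W.localMinimalModel v).c₄ = 0 := by
  unfold WeierstrassCurve.localMinimalModel WeierstrassCurve.minimal
  rw [variableChange_c₄]
  simp [WeierstrassCurve.baseChange, map_c₄, hW]

/-- A curve with `c₄ = 0` (i.e. `j = 0`) has no place of multiplicative reduction: multiplicative
reduction at `v` requires `ord_v(c₄) = 0` for a minimal model.
[cite: MochizukiGenEll2010, Lem 3.7 p.18] -/
theorem not_hasMultiplicativeReductionAt_of_c₄_eq_zero (v : HeightOneSpectrum A)
    (W : WeierstrassCurve K) (hW : W.c₄ = 0) : ¬ W.HasMultiplicativeReductionAt v := by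
  intro h
  have h1 := h.multiplicativeReduction
  rw [localMinimalModel_c₄_eq_zero v W hW, map_zero] at h1
  exact zero_ne_one h1

end MultPlace

/-- `E₀ : y² + y = x³` over `ℚ` has NO prime of multiplicative reduction (`j = 0`: potentially
good reduction everywhere). [cite: MochizukiGenEll2010, Lem 3.7 p.18] -/
theorem not_hasMultPlace_ofJ_zero : ¬ (⟨ℚ, ofJ 0⟩ : EllPoint).HasMultPlace := by
  rintro ⟨v, hv⟩
  exact not_hasMultiplicativeReductionAt_of_c₄_eq_zero v _ ofJ_zero_rat_c₄ hv

/-- **F-2744 settled as typed**: the universal closure of the predicate `EllPoint.HasMultPlace`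
("every presented elliptic curve has a prime of multiplicative reduction") is FALSE, witnessed by
`y² + y = x³` over `ℚ`. [cite: MochizukiGenEll2010, Lem 3.7 p.18] -/
theorem not_forall_hasMultPlace : ¬ ∀ P : EllPoint, P.HasMultPlace :=
  fun h => not_hasMultPlace_ofJ_zero (h _)

/-- The coefficients of `E₀` base-changed to `Q̄`: `a₁ = a₂ = a₄ = a₆ = 0`, `a₃ = 1`.
[cite: MochizukiGenEll2010, §3 p.16] -/
theorem ofJ_zero_baseChange_coeffs :
    ((ofJ (0 : ℚ)).baseChange (AlgebraicClosure ℚ)).toAffine.a₁ = 0 ∧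
    ((ofJ (0 : ℚ)).baseChange (AlgebraicClosure ℚ)).toAffine.a₂ = 0 ∧
    ((ofJ (0 : ℚ)).baseChange (AlgebraicClosure ℚ)).toAffine.a₃ = 1 ∧
    ((ofJ (0 : ℚ)).baseChange (AlgebraicClosure ℚ)).toAffine.a₄ = 0 ∧
    ((ofJ (0 : ℚ)).baseChange (AlgebraicClosure ℚ)).toAffine.a₆ = 0 := by
  rw [ofJ_zero_rat]
  simp [WeierstrassCurve.ofJ0, WeierstrassCurve.baseChange]

/-- A point `(x, y)` with `y² + y = x³` and `2y + 1 ≠ 0` is a nonsingular point of `E₀` over `Q̄`.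
[cite: MochizukiGenEll2010, §3 p.16] -/
theorem nonsingular_ofJ_zero {x y : AlgebraicClosure ℚ} (heq : y ^ 2 + y = x ^ 3)
    (hy : 2 * y + 1 ≠ 0) :
    ((ofJ (0 : ℚ)).baseChange (AlgebraicClosure ℚ)).toAffine.Nonsingular x y := by
  obtain ⟨h1, h2, h3, h4, h6⟩ := ofJ_zero_baseChange_coeffs
  rw [Affine.nonsingular_iff, Affine.equation_iff, h1, h2, h3, h4, h6]
  exact ⟨by linear_combination heq, Or.inr fun h => hy (by linear_combination h)⟩

/-- `negY` on `E₀` over `Q̄`: `−(x, y) = (x, −y − 1)`. [cite: MochizukiGenEll2010, §3 p.16] -/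
theorem negY_ofJ_zero (x y : AlgebraicClosure ℚ) :
    ((ofJ (0 : ℚ)).baseChange (AlgebraicClosure ℚ)).toAffine.negY x y = -y - 1 := by
  obtain ⟨h1, -, h3, -, -⟩ := ofJ_zero_baseChange_coeffs
  rw [Affine.negY, h1, h3]
  ring

/-- Doubling on `E₀` (`a₁ = a₂ = a₄ = 0`, `a₃ = 1`): if the tangent slope `3x²/(2y+1)` at `(x, y)`
satisfies `(3x²/(2y+1))² = 3x` — true at the flexes `(0,0)` and `(−1, ω)` — then
`(x,y) + (x,y) = −(x,y)`, i.e. `(x, y)` is `3`-torsion. [cite: MochizukiGenEll2010, Lem 3.5 p.17] -/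
theorem add_self_eq_neg_ofJ_zero {x y : AlgebraicClosure ℚ} (heq : y ^ 2 + y = x ^ 3)
    (hy : 2 * y + 1 ≠ 0) (hflex : (3 * x ^ 2 / (2 * y + 1)) ^ 2 = 3 * x) :
    (Affine.Point.some x y (nonsingular_ofJ_zero heq hy) :
        ((ofJ (0 : ℚ)).baseChange (AlgebraicClosure ℚ)).toAffine.Point)
      + Affine.Point.some x y (nonsingular_ofJ_zero heq hy)
      = -Affine.Point.some x y (nonsingular_ofJ_zero heq hy) := by
  obtain ⟨h1, h2, -, h4, -⟩ := ofJ_zero_baseChange_coeffs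
  have hy' : y ≠ ((ofJ (0 : ℚ)).baseChange (AlgebraicClosure ℚ)).toAffine.negY x y := by
    rw [negY_ofJ_zero]
    exact fun h => hy (by linear_combination h)
  rw [Affine.Point.add_self_of_Y_ne' hy', Affine.Point.neg_some, Affine.Point.neg_some]
  have hslope : ((ofJ (0 : ℚ)).baseChange (AlgebraicClosure ℚ)).toAffine.slope x x y y
      = 3 * x ^ 2 / (2 * y + 1) := by
    rw [Affine.slope_of_Y_ne rfl hy', negY_ofJ_zero, h1, h2, h4]
    congr 1 <;> ring
  have hX : ((ofJ (0 : ℚ)).baseChange (AlgebraicClosure ℚ)).toAffine.addX x x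
      (((ofJ (0 : ℚ)).baseChange (AlgebraicClosure ℚ)).toAffine.slope x x y y) = x := by
    simp only [Affine.addX, hslope, h1, h2]
    linear_combination hflex
  have hY : ((ofJ (0 : ℚ)).baseChange (AlgebraicClosure ℚ)).toAffine.negAddY x x y
      (((ofJ (0 : ℚ)).baseChange (AlgebraicClosure ℚ)).toAffine.slope x x y y) = y := by
    simp only [Affine.negAddY, hX, sub_self, mul_zero, zero_add]
  simp only [hX, hY]

/-- The flex `T = (0, 0)` of `E₀` is a nonsingular point.
[cite: MochizukiGenEll2010, Lem 3.5 p.17] -/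
theorem nonsingular_ofJ_zero_origin :
    ((ofJ (0 : ℚ)).baseChange (AlgebraicClosure ℚ)).toAffine.Nonsingular 0 0 :=
  nonsingular_ofJ_zero (x := 0) (y := 0) (by ring) (by norm_num)

/-- The flex `T = (0,0)` is fixed by every `σ ∈ Γ_ℚ` (its coordinates are rational).
[cite: MochizukiGenEll2010, Lem 3.5 p.17] -/
theorem map_origin (σ : AlgebraicClosure ℚ ≃ₐ[ℚ] AlgebraicClosure ℚ) :
    Affine.Point.map (σ : AlgebraicClosure ℚ →ₐ[ℚ] AlgebraicClosure ℚ)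
        (Affine.Point.some 0 0 nonsingular_ofJ_zero_origin)
      = Affine.Point.some 0 0 nonsingular_ofJ_zero_origin := by
  rw [Affine.Point.map_some]
  simp only [map_zero]

/-- A primitive cube root of unity `ω ∈ Q̄`: `ω² + ω + 1 = 0`.
[cite: MochizukiGenEll2010, Lem 3.5 p.17] -/
theorem exists_omega : ∃ ω : AlgebraicClosure ℚ, ω ^ 2 + ω + 1 = 0 := by
  obtain ⟨ω, hω⟩ := IsAlgClosed.exists_root
    (Polynomial.X ^ 2 + Polynomial.X + 1 : Polynomial (AlgebraicClosure ℚ)) (by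
      have hdeg :
          (Polynomial.X ^ 2 + Polynomial.X + 1 : Polynomial (AlgebraicClosure ℚ)).degree = 2 := by
        compute_degree!
      rw [hdeg]
      norm_num)
  refine ⟨ω, ?_⟩
  simpa only [Polynomial.IsRoot.def, Polynomial.eval_add, Polynomial.eval_pow, Polynomial.eval_X,
    Polynomial.eval_one] using hω

/-- `x³ = −1/4` has no rational solution (the `2`-adic valuation of `(−2x)³ = 2` would be
`3·v₂(−2x) = 1`). [cite: MochizukiGenEll2010, Lem 3.5 p.17] -/
theorem rat_cube_ne_neg_quarter (x : ℚ) : x ^ 3 ≠ -1 / 4 := by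
  intro h
  have h2 : (-2 * x) ^ 3 = (2 : ℕ) := by
    push_cast
    linear_combination (-8 : ℚ) * h
  have hv := congrArg (padicValRat 2) h2
  rw [padicValRat.pow, padicValRat.of_nat, padicValNat.self (by norm_num)] at hv
  omega

/-- `E₀ : y² + y = x³` has no `Γ_ℚ`-fixed geometric point of order `2`: such a point `(x, y)` has
`2y + 1 = 0` and rational coordinates (Galois descent), so `x³ = y² + y = −1/4` with `x ∈ ℚ`,
impossible. [cite: MochizukiGenEll2010, Lem 3.5 p.17] -/
theorem no_fixed_two_torsion_ofJ_zero (P : (ofJ (0 : ℚ)).geomPoints) (hP0 : P ≠ 0)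
    (h2 : P + P = 0) (hfix : ∀ σ : Field.absoluteGaloisGroup ℚ, σ • P = P) : False := by
  -- `AlgebraicClosure ℚ` carries two (definitionally equal) `ℚ`-algebra structures; register the
  -- Galois instances for the one found by instance search here.
  haveI : Algebra.IsAlgebraic ℚ (AlgebraicClosure ℚ) := AlgebraicClosure.isAlgebraic ℚ
  haveI : IsAlgClosure ℚ (AlgebraicClosure ℚ) := ⟨inferInstance, inferInstance⟩
  haveI : IsGalois ℚ (AlgebraicClosure ℚ) := IsGalois.mk
  obtain ⟨h1, h2c, h3, h4, h6⟩ := ofJ_zero_baseChange_coeffs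
  change ((ofJ (0 : ℚ)).baseChange (AlgebraicClosure ℚ)).toAffine.Point at P
  rcases P with _ | ⟨x, y, hxy⟩
  · exact hP0 rfl
  · -- `2y + 1 = 0`: otherwise `P + P` is an affine point
    have h2' : (Affine.Point.some x y hxy :
        ((ofJ (0 : ℚ)).baseChange (AlgebraicClosure ℚ)).toAffine.Point)
          + Affine.Point.some x y hxy = 0 := h2
    have hy : y = ((ofJ (0 : ℚ)).baseChange (AlgebraicClosure ℚ)).toAffine.negY x y := by
      by_contra hy
      rw [Affine.Point.add_self_of_Y_ne hy] at h2'
      exact Affine.Point.some_ne_zero _ h2'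
    rw [negY_ofJ_zero] at hy
    -- the equation `y² + y = x³`
    have heq : y ^ 2 + y = x ^ 3 := by
      have := hxy.1
      rw [Affine.equation_iff, h1, h2c, h3, h4, h6] at this
      linear_combination this
    -- `x` is fixed by `Γ_ℚ`, hence rational
    have hx : ∀ σ : AlgebraicClosure ℚ ≃ₐ[ℚ] AlgebraicClosure ℚ, σ x = x := by
      intro σ
      have := hfix σ
      change Affine.Point.map (σ : AlgebraicClosure ℚ →ₐ[ℚ] AlgebraicClosure ℚ)
        (Affine.Point.some x y hxy) = Affine.Point.some x y hxy at this
      rw [Affine.Point.map_some] at this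
      have hboth : σ x = x ∧ σ y = y := by
        simpa only [Affine.Point.some.injEq, AlgEquiv.coe_toAlgHom] using this
      exact hboth.1
    obtain ⟨x₀, rfl⟩ := (InfiniteGalois.mem_range_algebraMap_iff_fixed x).mpr hx
    -- `x₀³ = -1/4` in `ℚ`
    have hcube : algebraMap ℚ (AlgebraicClosure ℚ) (x₀ ^ 3)
        = algebraMap ℚ (AlgebraicClosure ℚ) (-1 / 4) := by
      rw [map_pow, map_div₀, map_neg, map_one]
      have hy' : y = -1 / 2 := by linear_combination hy / 2
      rw [hy'] at heq
      have : (algebraMap ℚ (AlgebraicClosure ℚ) x₀) ^ 3 = -1 / 4 := by linear_combination -heq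
      rw [this]
      norm_num
    exact rat_cube_ne_neg_quarter x₀ ((algebraMap ℚ (AlgebraicClosure ℚ)).injective hcube)

/-- `E₀ : y² + y = x³` over `ℚ` admits NO `Γ_ℚ`-stable subgroup of order `2` of `E₀[2]` (no
"`2`-cyclic subgroup scheme", i.e. no rational `2`-isogeny kernel: its `2`-division cubic `4x³ + 1`
has no rational root). [cite: MochizukiGenEll2010, Lem 3.5 p.17] -/
theorem not_admitsLCyclic_two_ofJ_zero : ¬ (⟨ℚ, ofJ 0⟩ : EllPoint).AdmitsLCyclic 2 := by
  rintro ⟨H, hH, hcard⟩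
  obtain ⟨T, hT0, huniq⟩ := (Nat.card_eq_two_iff' (0 : H)).mp hcard
  -- the underlying geometric point
  set P : (ofJ (0 : ℚ)).geomPoints :=
    ((T : ↥((ofJ (0 : ℚ)).geomTorsion ((2 : ℕ) : ℤ))) : (ofJ (0 : ℚ)).geomPoints) with hPdef
  have hP0 : P ≠ 0 := fun h => hT0 (Subtype.ext (Subtype.ext h))
  have hPtors : (2 : ℕ) • P = 0 :=
    AddSubgroup.torsionBy.nsmul_iff.mp (T : ↥((ofJ (0 : ℚ)).geomTorsion ((2 : ℕ) : ℤ))).2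
  have h2 : P + P = 0 := by rwa [two_nsmul] at hPtors
  have hfix : ∀ σ : Field.absoluteGaloisGroup ℚ, σ • P = P := by
    intro σ
    have hmem : σ • (T : ↥((ofJ (0 : ℚ)).geomTorsion ((2 : ℕ) : ℤ))) ∈ H := hH σ _ T.2
    have hne : (⟨σ • (T : ↥((ofJ (0 : ℚ)).geomTorsion ((2 : ℕ) : ℤ))), hmem⟩ : H) ≠ 0 := by
      intro h0
      apply hT0
      have h0' : σ • (T : ↥((ofJ (0 : ℚ)).geomTorsion ((2 : ℕ) : ℤ))) = 0 :=
        congrArg Subtype.val h0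
      rw [smul_eq_zero_iff_eq] at h0'
      exact Subtype.ext h0'
    exact congrArg
      (fun z : H => ((z : ↥((ofJ (0 : ℚ)).geomTorsion ((2 : ℕ) : ℤ))) : (ofJ (0 : ℚ)).geomPoints))
      (huniq _ hne)
  exact no_fixed_two_torsion_ofJ_zero P hP0 h2 hfix

/-- **F-2754 settled as typed**: the universal closure of `EllPoint.AdmitsLCyclic` ("every presented
elliptic curve admits an `l`-cyclic subgroup scheme for every `l`") is FALSE, witnessed by
`y² + y = x³` over `ℚ` at `l = 2`. (Instance forms remain meaningful hypotheses: the printed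
[GenEll] Lemma 3.5, `GenEll_lemma35`, ASSUMES `AdmitsLCyclic`.)
[cite: MochizukiGenEll2010, Lem 3.5 p.17] -/
theorem not_forall_admitsLCyclic : ¬ ∀ (P : EllPoint) (l : ℕ), P.AdmitsLCyclic l :=
  fun h => not_admitsLCyclic_two_ofJ_zero (h _ 2)

/-- `E₀ : y² + y = x³` over `ℚ`: the image of `Γ_ℚ` on `E₀[3]` does NOT contain `SL₂(𝔽₃)`. The
flexes `T = (0,0)` and `S = (−1, ω)` (`ω² + ω + 1 = 0`) are `3`-torsion points with `T ∉ 𝔽₃·S`; a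
linear form `φ` on `E₀[3]` with `φ(S) = 0 ≠ φ(T)` gives the transvection `x ↦ x + φ(x)·S` of
determinant `1` (Mathlib `LinearEquiv.transvection.det_eq_one`), which moves `T`; but `T` is
rational, hence fixed by every `σ ∈ Γ_ℚ`. [cite: MochizukiGenEll2010, Thm 3.8 p.19] -/
theorem not_imageModLContainsSL2_three_ofJ_zero :
    ¬ (⟨ℚ, ofJ 0⟩ : EllPoint).ImageModLContainsSL2 3 := by
  intro h
  unfold EllPoint.ImageModLContainsSL2 at h
  letI : Module (ZMod 3) ↥((ofJ (0 : ℚ)).geomTorsion ((3 : ℕ) : ℤ)) :=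
    AddSubgroup.torsionBy.zmodModule
  -- the two flexes `T = (0,0)` and `S = (-1, ω)`
  obtain ⟨ω, hω⟩ := exists_omega
  have hω2 : (2 * ω + 1) ^ 2 = -3 := by linear_combination (4 : AlgebraicClosure ℚ) * hω
  have hωy : 2 * ω + 1 ≠ 0 := fun h0 => by
    have : ((2 * ω + 1) ^ 2 : AlgebraicClosure ℚ) = 0 := by rw [h0]; ring
    norm_num [hω2] at this
  have hSeq : ω ^ 2 + ω = (-1) ^ 3 := by linear_combination hω
  have hSflex : (3 * (-1 : AlgebraicClosure ℚ) ^ 2 / (2 * ω + 1)) ^ 2 = 3 * (-1) := by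
    rw [div_pow, hω2]
    norm_num
  set Tpt : ((ofJ (0 : ℚ)).baseChange (AlgebraicClosure ℚ)).toAffine.Point :=
    Affine.Point.some 0 0 nonsingular_ofJ_zero_origin with hTpt
  set Spt : ((ofJ (0 : ℚ)).baseChange (AlgebraicClosure ℚ)).toAffine.Point :=
    Affine.Point.some (-1) ω (nonsingular_ofJ_zero hSeq hωy) with hSpt
  have hT3 : Tpt + Tpt = -Tpt :=
    add_self_eq_neg_ofJ_zero (x := 0) (y := 0) (by ring) (by norm_num) (by ring)
  have hS3 : Spt + Spt = -Spt := add_self_eq_neg_ofJ_zero hSeq hωy hSflex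
  -- as elements of `E₀[3]`
  have hTmem : (Tpt : (ofJ (0 : ℚ)).geomPoints) ∈ (ofJ (0 : ℚ)).geomTorsion ((3 : ℕ) : ℤ) := by
    refine AddSubgroup.torsionBy.nsmul_iff.mpr ?_
    show (3 : ℕ) • Tpt = 0
    rw [succ_nsmul, two_nsmul, hT3, neg_add_cancel]
  have hSmem : (Spt : (ofJ (0 : ℚ)).geomPoints) ∈ (ofJ (0 : ℚ)).geomTorsion ((3 : ℕ) : ℤ) := by
    refine AddSubgroup.torsionBy.nsmul_iff.mpr ?_
    show (3 : ℕ) • Spt = 0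
    rw [succ_nsmul, two_nsmul, hS3, neg_add_cancel]
  set T3 : ↥((ofJ (0 : ℚ)).geomTorsion ((3 : ℕ) : ℤ)) := ⟨_, hTmem⟩ with hT3def
  set S3 : ↥((ofJ (0 : ℚ)).geomTorsion ((3 : ℕ) : ℤ)) := ⟨_, hSmem⟩ with hS3def
  have hS3ne : S3 ≠ 0 := fun h0 => Affine.Point.some_ne_zero _ (congrArg Subtype.val h0 : Spt = 0)
  have hT3ne : T3 ≠ 0 := fun h0 => Affine.Point.some_ne_zero _ (congrArg Subtype.val h0 : Tpt = 0)
  -- `T ∉ 𝔽₃ · S` (compare `x`-coordinates: `x(T) = 0`, `x(±S) = -1`)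
  have hTS : (Tpt : ((ofJ (0 : ℚ)).baseChange (AlgebraicClosure ℚ)).toAffine.Point) ≠ Spt := by
    intro hts
    rw [hTpt, hSpt] at hts
    have := (Affine.Point.some.injEq _ _ _ _ _ _).mp hts
    norm_num at this
  have hTnegS : (Tpt : ((ofJ (0 : ℚ)).baseChange (AlgebraicClosure ℚ)).toAffine.Point) ≠ -Spt := by
    intro hts
    rw [hTpt, hSpt, Affine.Point.neg_some] at hts
    have := (Affine.Point.some.injEq _ _ _ _ _ _).mp hts
    norm_num at this
  have hnotmem : T3 ∉ Submodule.span (ZMod 3) ({S3} : Set _) := by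
    intro hmem
    rw [Submodule.mem_span_singleton] at hmem
    obtain ⟨a, ha⟩ := hmem
    rw [← ZMod.natCast_zmod_val a, Nat.cast_smul_eq_nsmul] at ha
    have hlt : a.val < 3 := ZMod.val_lt a
    have hval : a.val = 0 ∨ a.val = 1 ∨ a.val = 2 := by omega
    rcases hval with hv | hv | hv <;> rw [hv] at ha
    · rw [zero_nsmul] at ha
      exact hT3ne ha.symm
    · rw [one_nsmul] at ha
      exact hTS (congrArg Subtype.val ha).symm
    · rw [two_nsmul] at ha
      have : Spt + Spt = Tpt := congrArg Subtype.val ha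
      rw [hS3] at this
      exact hTnegS this.symm
  -- a linear form killing `S` but not `T`, and the transvection it defines (determinant `1`)
  obtain ⟨φ, hφT, hφS⟩ := Submodule.exists_dual_map_eq_bot_of_notMem hnotmem inferInstance
  have hφS0 : φ S3 = 0 := by
    rw [← Submodule.mem_bot (ZMod 3), ← hφS]
    exact Submodule.mem_map_of_mem (Submodule.subset_span rfl)
  have hdet : LinearMap.det (LinearMap.transvection φ S3) = 1 := by
    have hd := LinearEquiv.transvection.det_eq_one hφS0
    rwa [← Units.val_inj, LinearEquiv.coe_det, LinearEquiv.transvection.coe_toLinearMap hφS0,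
      Units.val_one] at hd
  obtain ⟨σ, hσ⟩ := h (LinearMap.transvection φ S3) hdet
  have hσT := hσ T3
  -- `σ • T = T` since `T` is rational; so `φ(T) • S = 0`, a contradiction
  have hfixT : σ • T3 = T3 := by
    apply Subtype.ext
    exact map_origin σ
  rw [LinearMap.transvection.apply, hfixT] at hσT
  have hTS0 : φ T3 • S3 = 0 := by rwa [eq_comm, add_eq_left] at hσT
  exact (smul_ne_zero hφT hS3ne) hTS0

/-- **F-2746 settled as typed**: the universal closure of `EllPoint.ImageModLContainsSL2` ("for
every presented elliptic curve and every `l`, the mod-`l` image of Galois contains `SL₂(𝔽_l)`") is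
FALSE, witnessed by `y² + y = x³` over `ℚ` at `l = 3` (a rational `3`-torsion point). The printed
[GenEll] Thm. 3.8 (`GenEll_thm38`) concludes it only for primes `l` satisfying its conditions
(a)/(b) and off a Galois-finite exceptional set; its conditional form is in
`GenEllFullGaloisProofs.lean`.
[cite: MochizukiGenEll2010, Thm 3.8 p.19] -/
theorem not_forall_imageModLContainsSL2 :
    ¬ ∀ (P : EllPoint) (l : ℕ) [NeZero l], P.ImageModLContainsSL2 l :=
  fun h => not_imageModLContainsSL2_three_ofJ_zero (h _ 3)

end Literature.NumberTheory.DiophantineGeometry.GenEll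

end
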